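import Mathlib
import Summits.Ventures.PercRepro2.Graph
import Summits.Ventures.PercRepro2.Exploration
import Summits.Ventures.PercRepro2.Harris
import Summits.Ventures.PercRepro2.GibbsPAJoint
import Summits.Ventures.PercRepro2.SepClusterJoint
import Summits.Ventures.PercRepro2.SepClusterSupport
import Summits.Ventures.PercRepro2.SepClusterHarris
import Summits.Ventures.PercRepro2.SepFamJoint
import Summits.Ventures.PercRepro2.SepFamSupport
import Summits.Ventures.PercRepro2.SepFamHarris
import Summits.Ventures.PercRepro2.SepFamPA

/-!
# Negative association across the separation for root sets, and the conditional BK inequality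
(G2) (blind cell PercRepro2, p3 g12, 2026-08-27; `proofs/P3-G2.md` Theorem B and (G2))

Conditioned on `{X ↮ Y}`, a monotone function of the `X`-tuple of clusters and a monotone
function of the `Y`-tuple are negatively correlated (`sep_fam_cross`).  COROLLARY (`sep_conn_fam`,
= (G2) of `P3-M9.md` §5, now a theorem): for vertices `p, q, r, s` with `{p, q}` disjoint from
`{r, s}` and `S = {{p,q} ↮ {r,s}}`,
  `P(S) · P(S ∧ p ↔ q ∧ r ↔ s) ≤ P(S ∧ p ↔ q) · P(S ∧ r ↔ s)`.
Edge weights strictly inside `(0, 1)`.  Own work; standard axioms.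
-/

namespace Summit.Ventures.PercRepro2

namespace SepPA

open Finset Classical

section FamilyCross

variable {V : Type*} {E : Type*} [Fintype V] [Fintype E] [DecidableEq E]
variable (ends : E → Sym2 V) (p : E → ℝ) (X Y : Finset V)

/-- Functions of the `X`-tuple monotone on the support of the `X`-marginal. -/
def IncXf (f : (X → Set V) → ℝ) : Prop :=
  ∀ k k' : X → Set V, (∑ t, Jf ends p X Y t k) ≠ 0 → (∑ t, Jf ends p X Y t k') ≠ 0 → k ≤ k' →
    f k ≤ f k'

variable {X Y}

/-- Monotone functions of tuples are monotone on the `X`-support. -/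
lemma incXf_of_monotone {f : (X → Set V) → ℝ} (hf : Monotone f) : IncXf ends p X Y f :=
  fun _ _ _ _ h => hf h

/-- The conditional expectation of an `IncXf` function given the `Y`-tuple is antitone on the
support: its negative is `IncYf`. -/
theorem incYf_neg_condS_transpose (hp01 : ∀ e, 0 < p e ∧ p e < 1) (hXY : Disjoint X Y)
    {f : (X → Set V) → ℝ} (hf : IncXf ends p X Y f) :
    IncYf ends p X Y
      (fun t => -(GibbsPAJoint.condS (GibbsPAJoint.transpose (Jf ends p X Y)) f t)) := by
  intro t t' ht ht' htt'
  simp only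
  rw [condS_transpose_eq_expect_fam ends p hp01 hXY f ht,
    condS_transpose_eq_expect_fam ends p hp01 hXY f ht']
  have : expect p (fun ω => f (explAway ends X (foot t') ω)) ≤
      expect p (fun ω => f (explAway ends X (foot t) ω)) := by
    apply expect_mono (isProbVec_of_interior p hp01)
    intro ω
    exact hf _ _ (explAway_mem_support_left ends p hp01 hXY ht' ω)
      (explAway_mem_support_left ends p hp01 hXY ht ω)
      (explAway_anti ends X (foot_mono htt') ω)
  linarith

/-- The expectation of `1_S · f(expl X)` through the `X`-marginal. -/
lemma expect_indicator_expl_x (hp01 : ∀ e, 0 < p e ∧ p e < 1) (hXY : Disjoint X Y)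
    (f : (X → Set V) → ℝ) :
    expect p (fun ω => (sepFam ends X Y).indicator (fun _ => (1 : ℝ)) ω * f (expl ends ω X))
      = prob p (sepFam ends X Y) * ∑ k, (∑ t, Jf ends p X Y t k) * f k := by
  have hS : prob p (sepFam ends X Y) ≠ 0 := ne_of_gt (prob_sepFam_pos ends p hp01 hXY)
  rw [expect_indicator_comp_eq_sum p (sepFam ends X Y) (fun ω => expl ends ω X) f,
    Finset.mul_sum]
  apply Finset.sum_congr rfl
  intro k _
  rw [sum_Jf_left, Set.inter_comm, ← explEvent_eq_preimage]
  field_simp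

/-- The expectation of `1_S · f(expl X) g(expl Y)` through the joint law. -/
lemma expect_indicator_expl_xy (hp01 : ∀ e, 0 < p e ∧ p e < 1) (hXY : Disjoint X Y)
    (f : (X → Set V) → ℝ) (g : (Y → Set V) → ℝ) :
    expect p (fun ω => (sepFam ends X Y).indicator (fun _ => (1 : ℝ)) ω *
        (f (expl ends ω X) * g (expl ends ω Y)))
      = prob p (sepFam ends X Y) * ∑ t, ∑ k, Jf ends p X Y t k * (f k * g t) := by
  have hS : prob p (sepFam ends X Y) ≠ 0 := ne_of_gt (prob_sepFam_pos ends p hp01 hXY)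
  have h := expect_indicator_comp_eq_sum p (sepFam ends X Y)
    (fun ω => (expl ends ω Y, expl ends ω X)) (fun tk => f tk.2 * g tk.1)
  simp only at h
  rw [h, Fintype.sum_prod_type, Finset.mul_sum]
  apply Finset.sum_congr rfl
  intro t _
  rw [Finset.mul_sum]
  apply Finset.sum_congr rfl
  intro k _
  unfold Jf
  have : sepFam ends X Y ∩ {ω | (expl ends ω Y, expl ends ω X) = (t, k)} =
      explEvent ends Y t ∩ explEvent ends X k ∩ sepFam ends X Y := by
    ext ω
    simp only [Set.mem_inter_iff, Set.mem_setOf_eq, Prod.mk.injEq, explEvent_eq_preimage]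
    tauto
  rw [this]
  field_simp

/-- **Negative association across the separation (Theorem B of `P3-G2.md`).** -/
theorem sep_fam_cross (hp01 : ∀ e, 0 < p e ∧ p e < 1) (hXY : Disjoint X Y)
    (f : (X → Set V) → ℝ) (g : (Y → Set V) → ℝ) (hf : Monotone f) (hg : Monotone g) :
    prob p (sepFam ends X Y) *
      expect p (fun ω => (sepFam ends X Y).indicator (fun _ => (1 : ℝ)) ω *
        (f (expl ends ω X) * g (expl ends ω Y))) ≤
    expect p (fun ω => (sepFam ends X Y).indicator (fun _ => (1 : ℝ)) ω * f (expl ends ω X)) *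
      expect p (fun ω => (sepFam ends X Y).indicator (fun _ => (1 : ℝ)) ω * g (expl ends ω Y)) := by
  have hJ0 : ∀ t k, 0 ≤ Jf ends p X Y t k := Jf_nonneg ends p hp01
  have hJ0' : ∀ k t, 0 ≤ GibbsPAJoint.transpose (Jf ends p X Y) k t := fun k t => hJ0 t k
  set A := GibbsPAJoint.condS (GibbsPAJoint.transpose (Jf ends p X Y)) f with hA
  have hjoint : ∑ t, ∑ k, Jf ends p X Y t k * (f k * g t) =
      ∑ t, (∑ k, Jf ends p X Y t k) * (g t * A t) := by
    apply Finset.sum_congr rfl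
    intro t _
    have m := GibbsPAJoint.marg_mul_condS (GibbsPAJoint.transpose (Jf ends p X Y)) hJ0' f t
    simp only [GibbsPAJoint.transpose] at m
    rw [hA]
    calc ∑ k, Jf ends p X Y t k * (f k * g t) = g t * ∑ k, Jf ends p X Y t k * f k := by
          rw [Finset.mul_sum]; apply Finset.sum_congr rfl; intro k _; ring
      _ = g t * ((∑ k, Jf ends p X Y t k) *
          GibbsPAJoint.condS (GibbsPAJoint.transpose (Jf ends p X Y)) f t) := by rw [m]
      _ = _ := by ring
  have htower : ∑ t, (∑ k, Jf ends p X Y t k) * A t = ∑ k, (∑ t, Jf ends p X Y t k) * f k := by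
    have := GibbsPAJoint.sum_marg_condS (GibbsPAJoint.transpose (Jf ends p X Y)) hJ0' f
    simp only [GibbsPAJoint.transpose] at this
    rw [hA]
    exact this
  have hcov := cov_nonneg_incYf ends p hp01 hXY g (fun t => -A t) (incYf_of_monotone ends p hg)
    (incYf_neg_condS_transpose ends p hp01 hXY (incXf_of_monotone ends p hf))
  unfold GibbsPAq.cov at hcov
  simp only [mul_neg, Finset.sum_neg_distrib] at hcov
  rw [expect_indicator_expl_xy ends p hp01 hXY f g, expect_indicator_expl_x ends p hp01 hXY f,
    expect_indicator_expl ends p hp01 hXY g, hjoint, ← htower]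
  have hS0 : 0 ≤ prob p (sepFam ends X Y) := le_of_lt (prob_sepFam_pos ends p hp01 hXY)
  have key : ∑ t, (∑ k, Jf ends p X Y t k) * (g t * A t) ≤
      (∑ t, (∑ k, Jf ends p X Y t k) * g t) * ∑ t, (∑ k, Jf ends p X Y t k) * A t := by
    linarith
  have := mul_le_mul_of_nonneg_left key (mul_nonneg hS0 hS0)
  nlinarith [this]

/-- **The conditional BK inequality (G2)**: for `{p, q}` disjoint from `{r, s}` and
`S = {{p,q} ↮ {r,s}}`, `P(S) · P(S ∧ p ↔ q ∧ r ↔ s) ≤ P(S ∧ p ↔ q) · P(S ∧ r ↔ s)`. -/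
theorem sep_conn_fam (hp01 : ∀ e, 0 < p e ∧ p e < 1) (a b c d : V)
    (hXY : Disjoint ({a, b} : Finset V) {c, d}) :
    prob p (sepFam ends {a, b} {c, d}) *
      prob p (sepFam ends {a, b} {c, d} ∩ (connEvent ends a b ∩ connEvent ends c d)) ≤
    prob p (sepFam ends {a, b} {c, d} ∩ connEvent ends a b) *
      prob p (sepFam ends {a, b} {c, d} ∩ connEvent ends c d) := by
  have ha : a ∈ ({a, b} : Finset V) := Finset.mem_insert_self a {b}
  have hc : c ∈ ({c, d} : Finset V) := Finset.mem_insert_self c {d}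
  let f : (({a, b} : Finset V) → Set V) → ℝ := fun k => if b ∈ k ⟨a, ha⟩ then 1 else 0
  let g : (({c, d} : Finset V) → Set V) → ℝ := fun t => if d ∈ t ⟨c, hc⟩ then 1 else 0
  have hf : Monotone f := by
    intro k k' h
    simp only [f]
    by_cases hb : b ∈ k ⟨a, ha⟩
    · simp [hb, h ⟨a, ha⟩ hb]
    · simp only [hb, if_false]
      split_ifs <;> norm_num
  have hg : Monotone g := by
    intro t t' h
    simp only [g]
    by_cases hd : d ∈ t ⟨c, hc⟩
    · simp [hd, h ⟨c, hc⟩ hd]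
    · simp only [hd, if_false]
      split_ifs <;> norm_num
  have H := sep_fam_cross ends p hp01 hXY f g hf hg
  have e1 : expect p (fun ω => (sepFam ends {a, b} {c, d}).indicator (fun _ => (1 : ℝ)) ω *
      (f (expl ends ω {a, b}) * g (expl ends ω {c, d}))) =
      prob p (sepFam ends {a, b} {c, d} ∩ (connEvent ends a b ∩ connEvent ends c d)) := by
    rw [prob_eq_expect_indicator]
    unfold expect
    apply Finset.sum_congr rfl
    intro ω _
    congr 1
    simp only [f, g, expl]
    by_cases hS : ω ∈ sepFam ends {a, b} {c, d} <;> by_cases hab : Conn ends ω a b <;>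
      by_cases hcd : Conn ends ω c d <;>
      simp [Set.mem_inter_iff, mem_connEvent, mem_cluster, hS, hab, hcd]
  have e2 : expect p (fun ω => (sepFam ends {a, b} {c, d}).indicator (fun _ => (1 : ℝ)) ω *
      f (expl ends ω {a, b})) = prob p (sepFam ends {a, b} {c, d} ∩ connEvent ends a b) := by
    rw [prob_eq_expect_indicator]
    unfold expect
    apply Finset.sum_congr rfl
    intro ω _
    congr 1
    simp only [f, expl]
    by_cases hS : ω ∈ sepFam ends {a, b} {c, d} <;> by_cases hab : Conn ends ω a b <;>
      simp [Set.mem_inter_iff, mem_connEvent, mem_cluster, hS, hab]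
  have e3 : expect p (fun ω => (sepFam ends {a, b} {c, d}).indicator (fun _ => (1 : ℝ)) ω *
      g (expl ends ω {c, d})) = prob p (sepFam ends {a, b} {c, d} ∩ connEvent ends c d) := by
    rw [prob_eq_expect_indicator]
    unfold expect
    apply Finset.sum_congr rfl
    intro ω _
    congr 1
    simp only [g, expl]
    by_cases hS : ω ∈ sepFam ends {a, b} {c, d} <;> by_cases hcd : Conn ends ω c d <;>
      simp [Set.mem_inter_iff, mem_connEvent, mem_cluster, hS, hcd]
  rw [e1, e2, e3] at H
  exact H

end FamilyCross

end SepPA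

end Summit.Ventures.PercRepro2
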